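import Mathlib
import Summits.NavierStokesRegularity.NavierStokesRegularity.Theorems.EulerZoomLiouvillePowerGaugeEulerLiouvilleDSSEndpointShellTools
import Summits.NavierStokesRegularity.NavierStokesRegularity.Theorems.EulerZoomLiouvillePowerGaugeEulerLiouvilleSelfSimilarEndpointMemberFull
import Summits.NavierStokesRegularity.NavierStokesRegularity.Theorems.EulerZoomLiouvillePowerGaugeEulerLiouvilleEnergyVanishingTools
import HarnessLib

/-!
# Rung C2 of the crux `EulerZoomLiouville.PowerGaugeEulerLiouville` at the endpoint `ρ = 1/2`:
# slices of a member of Seregin's class (measurability, energy, local integrability, pressure growth)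

Route №10 `EulerZoomLiouville` (NavierStokesRegularity), crux E = stmt-NavierStokesRegularity-19832,
tenure rung C2 (`Sig.rungC2_dss`) at the energy-conserving endpoint `ρ = 1/2`.  The DSS endpoint
stratum (`…DSSEndpointShell/PeriodFlux/Decay`) is stated with PER-SLICE hypotheses on one period;
this file derives them from the three hypotheses of the crux (no self-similarity is used):

* `ae_slice_aestronglyMeasurable`, `ae_slice_locallyIntegrable` — a.e. slice of an a.e.-strongly
  measurable / locally integrable field on the slab is a.e.-strongly measurable / locally integrable
  (Fubini on the boxes `[−n−1, −1/(n+1)] × B̄_{n+1}`);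
* `ae_slice_energy_of_gauge_half` — at `ρ = 1/2` the `A`-gauge gives `∫ |u(τ)|² ≤ c` for a.e.
  `τ < 0` (the lead's `lintegral_enorm_sq_le_of_gauge_half`);
* `ae_slice_cube_locallyIntegrable`, `ae_slice_pressure_velocity_locallyIntegrable`,
  `ae_slice_pressure_locallyIntegrable` — `|u(τ)|³, |p(τ)||u(τ)|, p(τ) ∈ L¹_loc` for a.e. `τ < 0`;
* `ae_slice_pressure_growth_of_gauge_half` — the `D`-gauge `a D(a) ≤ c` gives, for a.e. slice of a
  bounded time interval, the growth `∫_{B_L} |p(τ)|^{3/2} ≤ A_τ L²` (`L ≥ 1`): the weighted dyadic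
  series `Σ_k 4^{−k} ∫_{B_{2^k}} |p(τ)|^{3/2}` is integrable in `τ`, hence a.e. finite;
* `setIntegral_abs_le_of_lintegral_ball` — Hölder `(3/2, 3)` on a ball: then `∫_{B_L}|p(τ)| ≤ A' L^{7/3}`,
  the sub-cubic growth the lineage's `pressure_ae_eq_scaleQ_of_poisson` asks for.

WHAT THIS IS NOT: not NS, not E, not rung C2 — bookkeeping for one endpoint stratum.
-/

noncomputable section

-- flat `Theorems/<Route><Decl>…` files of one crux share the namespace of the crux (tree convention)
set_option linter.dupNamespace false

open MeasureTheory Set Filter Topology Metric Function TopologicalSpace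
open scoped ENNReal NNReal InnerProductSpace RealInnerProductSpace

namespace Summit.NavierStokesRegularity.NavierStokesRegularity.Theorems.PowerGaugeEulerLiouville

open Literature.Analysis Literature.Analysis.FunctionSpaces Literature.Analysis.FluidPDE

section Slices

variable {u : ℝ → EuclideanSpace ℝ (Fin 3) → EuclideanSpace ℝ (Fin 3)}
  {p : ℝ → EuclideanSpace ℝ (Fin 3) → ℝ}

/-- **A.e. slice of an a.e.-strongly measurable field on the slab is a.e.-strongly measurable.**
[folklore] -/
theorem ae_slice_aestronglyMeasurable
    (hum : AEStronglyMeasurable (uncurry u)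
      (volume.restrict (Iio (0 : ℝ) ×ˢ (univ : Set (EuclideanSpace ℝ (Fin 3)))))) :
    ∀ᵐ t : ℝ, t < 0 → AEStronglyMeasurable (u t) volume := by
  have hprod : (volume.restrict (Iio (0 : ℝ))).prod (volume : Measure (EuclideanSpace ℝ (Fin 3))) =
      volume.restrict (Iio (0 : ℝ) ×ˢ (univ : Set (EuclideanSpace ℝ (Fin 3)))) := by
    rw [Measure.restrict_prod_eq_prod_univ, ← Measure.volume_eq_prod]
  have hum' : AEStronglyMeasurable (uncurry u)
      ((volume.restrict (Iio (0 : ℝ))).prod (volume : Measure (EuclideanSpace ℝ (Fin 3)))) := by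
    rw [hprod]; exact hum
  exact (ae_restrict_iff' measurableSet_Iio).1 hum'.prodMk_left

/-- **A.e. slice of a locally integrable field on the slab is locally integrable.**  If
`g : ℝ × ℝ³ → F` is integrable on every compact subset of the slab `(−∞,0) × ℝ³`, then for a.e.
`τ < 0` the slice `g(τ, ·)` is locally integrable on `ℝ³` (Fubini on the boxes
`[−n−1, −1/(n+1)] × B̄_{n+1}`). [folklore] -/
theorem ae_slice_locallyIntegrable {F : Type*} [NormedAddCommGroup F]
    {g : ℝ × EuclideanSpace ℝ (Fin 3) → F}
    (hg : ∀ K : Set (ℝ × EuclideanSpace ℝ (Fin 3)), IsCompact K →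
      K ⊆ ((slab (EuclideanSpace ℝ (Fin 3)) (Iio 0) isOpen_Iio :
        Opens (ℝ × EuclideanSpace ℝ (Fin 3))) : Set (ℝ × EuclideanSpace ℝ (Fin 3))) →
      IntegrableOn g K volume) :
    ∀ᵐ τ : ℝ, τ < 0 → LocallyIntegrable (fun y => g (τ, y)) volume := by
  have key : ∀ n : ℕ, ∀ᵐ τ : ℝ, τ ∈ Icc (-(n : ℝ) - 1) (-(1 / ((n : ℝ) + 1))) →
      IntegrableOn (fun y => g (τ, y)) (closedBall (0 : EuclideanSpace ℝ (Fin 3)) ((n : ℝ) + 1)) volume := by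
    intro n
    set K : Set (ℝ × EuclideanSpace ℝ (Fin 3)) :=
      Icc (-(n : ℝ) - 1) (-(1 / ((n : ℝ) + 1))) ×ˢ closedBall (0 : EuclideanSpace ℝ (Fin 3)) ((n : ℝ) + 1)
      with hK
    have hKc : IsCompact K := isCompact_Icc.prod (isCompact_closedBall _ _)
    have hn : (0 : ℝ) < 1 / ((n : ℝ) + 1) := by positivity
    have hKS : K ⊆ ((slab (EuclideanSpace ℝ (Fin 3)) (Iio 0) isOpen_Iio :
        Opens (ℝ × EuclideanSpace ℝ (Fin 3))) : Set (ℝ × EuclideanSpace ℝ (Fin 3))) := by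
      rintro ⟨t, x⟩ ⟨ht, -⟩
      rw [SetLike.mem_coe, mem_slab]
      exact lt_of_le_of_lt ht.2 (by linarith)
    have hI : Integrable g ((volume.restrict (Icc (-(n : ℝ) - 1) (-(1 / ((n : ℝ) + 1))))).prod
        (volume.restrict (closedBall (0 : EuclideanSpace ℝ (Fin 3)) ((n : ℝ) + 1)))) := by
      rw [Measure.prod_restrict, ← Measure.volume_eq_prod]; exact hg K hKc hKS
    exact (ae_restrict_iff' measurableSet_Icc).1 hI.prod_right_ae
  have H := ae_all_iff.2 key
  filter_upwards [H] with τ hτ hτ0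
  rw [locallyIntegrable_iff]
  intro k hk
  obtain ⟨r, hkr⟩ := hk.isBounded.subset_closedBall (0 : EuclideanSpace ℝ (Fin 3))
  have hτ' : 0 < -τ := neg_pos.2 hτ0
  obtain ⟨n, hn⟩ := exists_nat_ge (max r (max (-τ) (1 / (-τ))))
  have hnr : r ≤ n := (le_max_left _ _).trans hn
  have hn1 : -τ ≤ n := (le_max_left _ _).trans ((le_max_right _ _).trans hn)
  have hn2 : 1 / (-τ) ≤ n := (le_max_right _ _).trans ((le_max_right _ _).trans hn)
  have hmem : τ ∈ Icc (-(n : ℝ) - 1) (-(1 / ((n : ℝ) + 1))) := by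
    refine ⟨by linarith, ?_⟩
    rw [le_neg, one_div_le (by positivity) hτ', one_div]
    have : (-τ)⁻¹ = 1 / (-τ) := (one_div _).symm
    linarith
  exact (hτ n hmem).mono_set (hkr.trans (closedBall_subset_closedBall (by linarith)))

/-- **Finite energy of a.e. slice at the endpoint.**  At `ρ = 1/2` the `A`-gauge `a A(a; 0) ≤ c`
gives `|u(τ)|² ∈ L¹(ℝ³)` with `∫ |u(τ)|² ≤ c` for a.e. `τ < 0` (every `τ` at which the slice is
measurable; the lead's `lintegral_enorm_sq_le_of_gauge_half`). [folklore] -/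
theorem ae_slice_energy_of_gauge_half {c : ℝ≥0}
    (hum : AEStronglyMeasurable (uncurry u)
      (volume.restrict (Iio (0 : ℝ) ×ˢ (univ : Set (EuclideanSpace ℝ (Fin 3))))))
    (hA : ∀ a : ℝ, 0 < a →
      ENNReal.ofReal (a ^ (2 * (1 / 2 : ℝ))) * cknA a (0 : ℝ × EuclideanSpace ℝ (Fin 3)) u ≤ (c : ℝ≥0∞)) :
    ∀ᵐ τ : ℝ, τ < 0 → Integrable (fun y => ‖u τ y‖ ^ 2) volume ∧ ∫ y, ‖u τ y‖ ^ 2 ≤ c := by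
  filter_upwards [ae_slice_aestronglyMeasurable hum] with τ hτ hτ0
  have hm := hτ hτ0
  have hle := lintegral_enorm_sq_le_of_gauge_half hA hτ0
  have hint := integrable_norm_sq_of_lintegral_lt_top hm (lt_of_le_of_lt hle ENNReal.coe_lt_top)
  refine ⟨hint, ?_⟩
  rw [integral_eq_lintegral_of_nonneg_ae (Eventually.of_forall fun y => by positivity)
    hint.aestronglyMeasurable]
  have e : ∫⁻ y, ENNReal.ofReal (‖u τ y‖ ^ 2) = ∫⁻ y, ‖u τ y‖ₑ ^ 2 :=
    lintegral_congr_ae (Eventually.of_forall fun y => by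
      show ENNReal.ofReal (‖u τ y‖ ^ 2) = ‖u τ y‖ₑ ^ 2
      rw [ENNReal.ofReal_pow (norm_nonneg _), ofReal_norm])
  rw [e]
  have := ENNReal.toReal_mono ENNReal.coe_ne_top hle
  rwa [ENNReal.coe_toReal] at this

/-- **`|u(τ)|³ ∈ L¹_loc` for a.e. slice** of a suitable weak pair on the slab. [folklore] -/
theorem ae_slice_cube_locallyIntegrable {ν : ℝ}
    (hsw : IsSuitableWeakSolutionOn (slab (EuclideanSpace ℝ (Fin 3)) (Iio 0) isOpen_Iio) ν 0 u p) :
    ∀ᵐ τ : ℝ, τ < 0 → LocallyIntegrable (fun y => ‖u τ y‖ ^ 3) volume :=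
  ae_slice_locallyIntegrable (g := fun z : ℝ × EuclideanSpace ℝ (Fin 3) => ‖u z.1 z.2‖ ^ 3)
    fun _ hK hKS => (locallyIntegrableOn_cube_of_suitable hsw).integrableOn_compact_subset hKS hK

/-- **`|p(τ)||u(τ)| ∈ L¹_loc` for a.e. slice** of a suitable weak pair on the slab. [folklore] -/
theorem ae_slice_pressure_velocity_locallyIntegrable {ν : ℝ}
    (hsw : IsSuitableWeakSolutionOn (slab (EuclideanSpace ℝ (Fin 3)) (Iio 0) isOpen_Iio) ν 0 u p) :
    ∀ᵐ τ : ℝ, τ < 0 → LocallyIntegrable (fun y => |p τ y| * ‖u τ y‖) volume :=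
  ae_slice_locallyIntegrable (g := fun z : ℝ × EuclideanSpace ℝ (Fin 3) => |p z.1 z.2| * ‖u z.1 z.2‖)
    fun _ hK hKS => integrableOn_pressure_velocity_of_suitable hsw hK hKS

/-- **`p(τ) ∈ L¹_loc` for a.e. slice** of a suitable weak pair on the slab (`p ∈ L^{3/2}` on compact
subsets of the slab, Lin's class). [folklore] -/
theorem ae_slice_pressure_locallyIntegrable {ν : ℝ}
    (hsw : IsSuitableWeakSolutionOn (slab (EuclideanSpace ℝ (Fin 3)) (Iio 0) isOpen_Iio) ν 0 u p) :
    ∀ᵐ τ : ℝ, τ < 0 → LocallyIntegrable (p τ) volume := by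
  refine ae_slice_locallyIntegrable (g := uncurry p) fun K hK hKS => ?_
  have hpm : AEStronglyMeasurable (uncurry p) (volume.restrict K) :=
    (hsw.distributional.2.2.1.mono_set hKS).aestronglyMeasurable
  haveI : IsFiniteMeasure (volume.restrict K) := isFiniteMeasure_restrict.2 (hK.measure_lt_top).ne
  have hmem : MemLp (uncurry p) (3 / 2 : ℝ≥0∞) (volume.restrict K) := by
    refine ⟨hpm, ?_⟩
    rw [eLpNorm_eq_lintegral_rpow_enorm_toReal (by simp) (ENNReal.div_ne_top (by norm_num) (by norm_num))]
    have htR : (3 / 2 : ℝ≥0∞).toReal = 3 / 2 := by norm_num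
    rw [htR]
    refine ENNReal.rpow_lt_top_of_nonneg (by norm_num) (ne_of_lt ?_)
    exact hsw.pressure K hKS hK
  have h32 : (1 : ℝ≥0∞) ≤ 3 / 2 := by
    rw [ENNReal.le_div_iff_mul_le (Or.inl two_ne_zero) (Or.inl ENNReal.ofNat_ne_top)]; norm_num
  exact hmem.integrable h32

end Slices

end Summit.NavierStokesRegularity.NavierStokesRegularity.Theorems.PowerGaugeEulerLiouville
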